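import Mathlib
import Summits.AnomalousDissipation.AnomalousDissipation.Theorems.SoloBlindWindow

/-!
# SoloBlind — floor mechanism II assembled at the caricature level (paper §24.19 (c), (f))

The end-to-end composition of the three kernel files of mechanism II:

* `SoloBlindMarginality` — N1: a positive steady pattern is nowhere more than `ε₂ = 4ε²`
  supercritical (enters here as the hypothesis `hmarg`);
* `SoloBlindWindow` — N1 + the two-parameter leaf map within `η₁` (H-loc) ⇒ window avoidance;
* `SoloBlindTuningRigidity` — window avoidance + no window jumping ⇒ a fat jet / fat slow-down block,
  and the tested leaf-mean balance on such a block ⇒ a mass floor.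

`dissipation_floor_mechanismII`: if, in addition, the leaf-mean balance can be TESTED on every
admissible block (`hbal`: for every block of consecutive band leaves of the length the structure theorem
guarantees there is a bump `χ ≥ 0` of mass `≥ θ` with `|Σ χ c u| ≤ C·m + r`, `m = Σ q` the
Reynolds-stress mass — hypothesis (H-bal) of the paper), then `u_* c₀ θ − r ≤ C·m`, and since the
reduced dissipation is `E₃ = ½ Σ eⱼ qⱼ` with `eⱼ ≥ e₀ ≥ 0` on the loaded leaves,
`E₃ ≥ e₀ (u_* c₀ θ − r) / (2C)`: a floor that does not see `h` except through the hypotheses.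
What is NOT proved here (the analytic inputs of R4c at the reduced level): (H-loc) with its `η₁`,
`NoWindowJump` (rounded contacts), and (H-bal).

`tested_balance_of_linear_response` records what (H-bal) amounts to in the reduced model, where the
leaf-mean speed-up is a LINEAR response `u = U q` of the nonnegative stress: the tested balance holds
with the exact constant `C = max_j |(Uᵀχ)_j|` and no remainder, so (H-bal) is the statement that this
adjoint response to a leafwise bump stays bounded as `h → 0` (paper §24.19 (f-ix)).

Mathlib + the sibling files only.
-/

namespace Summit.AnomalousDissipation.AnomalousDissipation.Theorems

open Finset

/-- **Floor mechanism II (caricature level).** See the module docstring. The block-count constant is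
`K = ⌈2u_*/(m/λ)⌉` (`λ = ⟨|V₀|²⟩/h`), and `θ` is a lower bound for the bump mass available on any
block `[a, a+L)` with `a + L ≤ N + 1` and `3L + 2K ≥ N + 1`. -/
theorem dissipation_floor_mechanismII (u μ σex σ0 b κ q e c : ℕ → ℝ) (N : ℕ) (A : Finset ℕ)
    (K0 η η1 ε2 us m lam θ C r c0 e0 : ℝ)
    (hlam : 0 < lam) (hm : 0 < m) (hus : 0 ≤ us) (hc0 : 0 ≤ c0) (he0 : 0 ≤ e0) (hC : 0 < C)
    (hμ : ∀ j, j < N → μ j = lam * leafStep u j)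
    (hband : ∀ j, j < N → η ≤ σ0 j - K0) (hσ0 : ∀ j, j < N → 0 ≤ σ0 j)
    (hκ : ∀ j, j < N → 0 ≤ κ j) (hu : ∀ j, j < N → -(1 / 2 : ℝ) ≤ u j)
    (hloc : ∀ j, j < N → |σex j - leafMap (σ0 j) (b j) (κ j) (u j) (μ j)| ≤ η1)
    (hmarg : ∀ j, j < N → σex j - K0 ≤ ε2)
    (hsmall : ∀ j, j < N → σ0 j * us + |b j| * m + 2 * κ j * m ^ 2 + η1 + ε2 < η)
    (hjump : NoWindowJump u N (m / lam))
    (hc : ∀ j, c0 ≤ c j)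
    (hq : ∀ j ∈ A, 0 ≤ q j) (he : ∀ j ∈ A, e0 ≤ e j)
    (hbal : ∀ a L : ℕ, a + L ≤ N + 1 → ((N : ℝ) + 1 ≤ 3 * L + 2 * (⌈2 * us / (m / lam)⌉₊ : ℕ)) →
      ∃ χ : ℕ → ℝ, (∀ j ∈ Ico a (a + L), 0 ≤ χ j) ∧ θ ≤ ∑ j ∈ Ico a (a + L), χ j ∧
        |∑ j ∈ Ico a (a + L), χ j * c j * u j| ≤ C * (∑ j ∈ A, q j) + r) :
    us * c0 * θ - r ≤ C * ∑ j ∈ A, q j ∧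
      e0 * (us * c0 * θ - r) / (2 * C) ≤ (1 / 2) * ∑ j ∈ A, e j * q j := by
  -- structure theorem: a fat block
  obtain ⟨a, L, haL, hlen, hfat⟩ :=
    fat_block_of_marginal u μ σex σ0 b κ N K0 η η1 ε2 us m lam hlam hm hμ hband hσ0 hκ hu hloc hmarg
      hsmall hjump
  -- test the balance on it
  obtain ⟨χ, hχ, hθ, hb⟩ := hbal a L haL hlen
  have hfat' : (∀ j ∈ Ico a (a + L), us ≤ u j) ∨ (∀ j ∈ Ico a (a + L), u j ≤ -us) := by
    rcases hfat with h | h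
    · left; intro j hj; have := mem_Ico.mp hj; exact h j this.1 this.2
    · right; intro j hj; have := mem_Ico.mp hj; exact h j this.1 this.2
  have hfloor := mass_floor_of_fat_run (Ico a (a + L)) χ c u us c0 C (∑ j ∈ A, q j) r hχ
    (fun j _ => hc j) hc0 hus hfat' hb
  -- us c0 θ ≤ us c0 Σχ ≤ C m + r
  have h1 : us * c0 * θ ≤ us * c0 * ∑ j ∈ Ico a (a + L), χ j :=
    mul_le_mul_of_nonneg_left hθ (mul_nonneg hus hc0)
  have hmass : us * c0 * θ - r ≤ C * ∑ j ∈ A, q j := by linarith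
  refine ⟨hmass, ?_⟩
  -- E₃ = ½ Σ e q ≥ ½ e₀ m ≥ e₀ (us c0 θ − r)/(2C)
  have hm0 : 0 ≤ ∑ j ∈ A, q j := sum_nonneg hq
  have hE : e0 * ∑ j ∈ A, q j ≤ ∑ j ∈ A, e j * q j := by
    rw [mul_sum]
    exact sum_le_sum (fun j hj => mul_le_mul_of_nonneg_right (he j hj) (hq j hj))
  have h2 : e0 * (us * c0 * θ - r) ≤ e0 * (C * ∑ j ∈ A, q j) := mul_le_mul_of_nonneg_left hmass he0
  have h3 : e0 * (us * c0 * θ - r) / (2 * C) ≤ e0 * (∑ j ∈ A, q j) / 2 := by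
    rw [div_le_div_iff₀ (by linarith) (by norm_num : (0:ℝ) < 2)]
    nlinarith
  linarith

/-- **(H-bal) in the reduced model is a linear-response bound.** If the speed-up on the tested leaves is
a linear response `u i = ∑ j ∈ A, U i j * q j` of a nonnegative stress and the adjoint response to the
bump is bounded on the loaded leaves, `|∑ i ∈ B, χ i * U i j| ≤ C`, then `|∑ i ∈ B, χ i * u i| ≤ C * ∑ q`
— the hypothesis `hbal` above with `c ≡ 1`, `r = 0`. -/
theorem tested_balance_of_linear_response (A B : Finset ℕ) (χ q u : ℕ → ℝ) (U : ℕ → ℕ → ℝ)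
    (C : ℝ) (hu : ∀ i ∈ B, u i = ∑ j ∈ A, U i j * q j) (hq : ∀ j ∈ A, 0 ≤ q j)
    (hC : ∀ j ∈ A, |∑ i ∈ B, χ i * U i j| ≤ C) :
    |∑ i ∈ B, χ i * u i| ≤ C * ∑ j ∈ A, q j := by
  have hswap : ∑ i ∈ B, χ i * u i = ∑ j ∈ A, (∑ i ∈ B, χ i * U i j) * q j := by
    calc ∑ i ∈ B, χ i * u i = ∑ i ∈ B, ∑ j ∈ A, χ i * U i j * q j := by
          refine Finset.sum_congr rfl fun i hi => ?_
          rw [hu i hi, Finset.mul_sum]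
          exact Finset.sum_congr rfl fun j _ => by ring
      _ = ∑ j ∈ A, ∑ i ∈ B, χ i * U i j * q j := Finset.sum_comm
      _ = ∑ j ∈ A, (∑ i ∈ B, χ i * U i j) * q j := by
          refine Finset.sum_congr rfl fun j _ => ?_
          rw [Finset.sum_mul]
  rw [hswap, Finset.mul_sum]
  calc |∑ j ∈ A, (∑ i ∈ B, χ i * U i j) * q j|
        ≤ ∑ j ∈ A, |(∑ i ∈ B, χ i * U i j) * q j| := Finset.abs_sum_le_sum_abs _ _
    _ = ∑ j ∈ A, |∑ i ∈ B, χ i * U i j| * q j := by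
          refine Finset.sum_congr rfl fun j hj => ?_
          rw [abs_mul, abs_of_nonneg (hq j hj)]
    _ ≤ ∑ j ∈ A, C * q j :=
          Finset.sum_le_sum fun j hj => mul_le_mul_of_nonneg_right (hC j hj) (hq j hj)

/-- The weighted form consumed by `mass_floor_of_fat_run` / `dissipation_floor_mechanismII`
(`c ≡ 1`, `r = 0`). -/
theorem tested_balance_weighted_one (A B : Finset ℕ) (χ q u : ℕ → ℝ) (U : ℕ → ℕ → ℝ)
    (C : ℝ) (hu : ∀ i ∈ B, u i = ∑ j ∈ A, U i j * q j) (hq : ∀ j ∈ A, 0 ≤ q j)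
    (hC : ∀ j ∈ A, |∑ i ∈ B, χ i * U i j| ≤ C) :
    |∑ i ∈ B, χ i * (fun _ => (1 : ℝ)) i * u i| ≤ C * (∑ j ∈ A, q j) + 0 := by
  simpa using tested_balance_of_linear_response A B χ q u U C hu hq hC

end Summit.AnomalousDissipation.AnomalousDissipation.Theorems
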